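import Literature.NumberTheory.Transcendental.BoundedPeriodComputable
import HarnessLib

/-!
# Finite-volume semialgebraic sets: computable volume from tail decay (Yoshinaga's theorem, route B)

Yoshinaga's computability statement for real Kontsevich–Zagier periods
(`Literature.NumberTheory.Transcendental.isComputableReal_of_isRealPeriod`, [Yoshinaga 2008, Thm.
18]; `PeriodConjecture.lean`) concerns integrals `∫_σ p/q` whose domain `σ` and integrand `p/q` may
both be unbounded. Every printed proof first makes them bounded — Yoshinaga's Lemma 24 (i),
Tent–Ziegler [2010, Cor. 6.4] and Viu-Sos [2021, Thm. 1.1] all invoke Hironaka's rectilinearization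
/ resolution of singularities — and the tree proves everything downstream of that reduction
(`SemialgebraicVolumeComputable.lean`, `BoundedPeriodComputable.lean`:
`isComputableReal_of_isRealPeriod_of_boundedReduction`, `…_of_boundedRepresentation`).

This file records a second, resolution-free route. By "the integral is the area under the graph"
[Kontsevich–Zagier 2001, §1.1] a real period is `vol(E₊) − vol(E₋)` for two `ℚ`-semialgebraic sets
`E± ⊆ ℝⁿ⁺¹` of *finite volume* (possibly unbounded), and the volume of such a set `E ⊆ ℝ^m` is
squeezed by *computable* double sequences: the dyadic cube counts of `E` inside the boxes `[−r,
r]^m` are primitive recursive in `(r, mesh)` (the cube tests are membership of a rational parameter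
point in the fixed `ℚ`-semialgebraic sets `innerParams E`, `outerParams E` of
`SemialgebraicVolumeComputable`, decided by Tarski–Seidenberg), the inner count is `≤ vol E`, the
outer count is `≥ vol(E ∩ [−r, r)^m)`, and their difference tends to `0` with the mesh for each
fixed box (the compact null set `∂E ∩ [−r, r]^m`). Hence `vol E` is a computable real as soon as the
*tail* `vol(E ∖ B(0, R))` has a computable majorant tending to `0`; since a computable real only
requires the *existence* of a machine, the qualitative estimate `vol(E ∖ B(0, R)) = O(R^{−a})` for
some `a > 0` suffices. That estimate is a published theorem of tame integration theory: `R ↦ vol(E ∖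
B(0, R))` is a *constructible* function (a sum of products of globally subanalytic functions and
their logarithms) by the stability of constructible functions under integration [Cluckers–Miller
2011, Thm. 1.3], and a constructible function of one variable tending to `0` at `+∞` is `≤ R^{−r}`
for large `R` [Cluckers–Miller 2011, Prop. 1.5 (Decay rates)]. Its proof rests on the Lion–Rolin
preparation theorem for subanalytic and constructible functions — a theory not in the tree — so it
enters here as the explicit hypothesis `H` of the final theorems and is deliberately NOT vendored as
a named fact (D-0026).

## Main statements

* `SemialgVolume.lo_le_of_ne_top`, `volume_inter_box_le_hi`, `hi_sub_lo_le_local`,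
  `exists_hi_sub_lo_le_of_isSemialgebraic` — the Riemann-sum squeeze of
  `SemialgebraicVolumeComputable.lean` for sets of finite volume that need not be bounded.
* `SemialgVolume.primrec_innerCount_shift`, `primrec_outerCount_shift` — the cube counts of the
  translates `E + ρ(n)·1` in the boxes `[0, 2ρ(n)]^m` are primitive recursive in `(n, mesh)`.
* `SemialgVolume.isComputableReal_volume_of_tailSeq` — finite volume + an effective tail `vol(E ∖
  [−ρ(n), ρ(n))^m) ≤ 2^{−(n+2)}` (`ρ` primitive recursive) ⇒ `vol E` computable.
* `SemialgVolume.isComputableReal_volume_of_tailDecay` — finite volume + `vol(E ∖ B(0,R)) ≤ C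
  R^{−a}` ⇒ `vol E` computable.
* `KZ.IntegralRep.isComputableReal_value_of_tailDecay`,
  `isComputableReal_of_isRealPeriod_of_tailDecay`, `isComputableComplex_of_isPeriod_of_tailDecay` —
  Yoshinaga's computability statements (the named facts of `PeriodConjecture.lean`) follow from the
  tail-decay theorem of Cluckers–Miller for finite-volume `ℚ`-semialgebraic sets, taken as
  hypothesis.

## References

* M. Yoshinaga, *Periods and elementary real numbers*, arXiv:0805.0349 (2008), §3.1 Thm. 18, §3.2
  Lemma 24, §3.4 Lemma 26.
* K. Tent, M. Ziegler, *Computable functions of reals*, Münster J. Math. 3 (2010), 43–66, §6, Cor.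
  6.4.
* J. Viu-Sos, *A semi-canonical reduction for periods of Kontsevich–Zagier*, Int. J. Number Theory
  17 (2021), 147–174, Thm. 1.1, Cor. 2.3.
* R. Cluckers, D. J. Miller, *Stability under integration of sums of products of real globally
  subanalytic functions and their logarithms*, Duke Math. J. 156 (2011), no. 2 (arXiv:0911.4373),
  Thm. 1.3 (stability under integration), Prop. 1.5 (decay rates).
* G. Comte, J.-M. Lion, J.-P. Rolin, *Nature log-analytique du volume des sous-analytiques*,
  Illinois J. Math. 44 (2000), 884–888.
* J.-M. Lion, J.-P. Rolin, *Intégration des fonctions sous-analytiques et volumes des sous-ensembles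
  sous-analytiques*, Ann. Inst. Fourier 48 (1998), 755–767.
* M. Kontsevich, D. Zagier, *Periods* (2001), §1.1.
* K. Weihrauch, *Computable Analysis*, Springer (2000), Def. 4.1.13, Lemma 4.2.1.

## Design notes

* No definitions and no named facts are introduced (theorems only); translates are written as the
  set-builder `{y | (fun i => y i - r) ∈ E}`. The grid, the cube tests and the primitive recursive
  kit are those of `SemialgebraicVolumeComputable.lean` and `ComputableRealProofs.lean`; the
  subgraph passage is `KZ.IntegralRep.volume_subgraph_eq` of `BoundedPeriodComputable.lean`.
* The hypothesis `H` of the last three theorems is stated for all `ℚ`-semialgebraic sets of finite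
  volume in all dimensions, with sup-norm balls (`Metric.ball 0 R` in `Fin m → ℝ`) and real powers
  `R ^ (-a)`; it is used only for the two subgraphs in dimension `n + 1`.
-/

noncomputable section

open MeasureTheory Set Metric Filter Topology
open scoped ENNReal
open Literature.ModelTheory.ExponentialFields

namespace Literature.NumberTheory.Transcendental

namespace SemialgVolume

variable {m : ℕ} {S : Set (Fin m → ℝ)} {r : ℕ}

/-- Lower bound without boundedness: the inner Riemann sum over the grid on `[0, r]^m` is at most
`vol S` for every `S` of finite volume. [folklore] -/
theorem lo_le_of_ne_top (hS : volume S ≠ ⊤) (n : ℕ) :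
    ((lo S r n : ℚ) : ℝ) ≤ (volume S).toReal := by
  classical
  set I := (Finset.range ((r * 2 ^ n) ^ m)).filter fun e => cbox (m := m) (r * 2 ^ n) n e ⊆ S
    with hIdef
  have hI : ∀ e ∈ I, e < (r * 2 ^ n) ^ m := fun e he =>
    Finset.mem_range.1 (Finset.mem_filter.1 he).1
  have hU : (⋃ e ∈ I, obox (m := m) (r * 2 ^ n) n e) ⊆ S := by
    intro x hx
    simp only [mem_iUnion, exists_prop] at hx
    obtain ⟨e, he, hx⟩ := hx
    exact (Finset.mem_filter.1 he).2 (obox_subset_cbox _ _ _ hx)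
  have h1 := volume_biUnion_obox (n := n) I hI
  have h2 : volume (⋃ e ∈ I, obox (m := m) (r * 2 ^ n) n e) ≤ volume S := measure_mono hU
  rw [h1] at h2
  have h3 := ENNReal.toReal_mono hS h2
  rw [ENNReal.toReal_mul, ENNReal.toReal_natCast, ENNReal.toReal_ofReal (by positivity)] at h3
  rw [lo, cast_card_div_eq]
  exact h3

/-- The outer count is monotone in the set. [folklore] -/
theorem outerCount_mono {S T : Set (Fin m → ℝ)} (hST : S ⊆ T) (r n : ℕ) :
    outerCount S r n ≤ outerCount T r n := by
  classical
  unfold outerCount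
  refine Finset.card_le_card (fun e he => ?_)
  rw [Finset.mem_filter] at he ⊢
  obtain ⟨he, x, hxC, hxS⟩ := he
  exact ⟨he, x, hxC, hST hxS⟩

/-- Upper bound for the part of `S` inside the box: `vol(S ∩ [0, r)^m) ≤ hi_n(S)`. [folklore] -/
theorem volume_inter_box_le_hi (S : Set (Fin m → ℝ)) (r n : ℕ) :
    (volume (S ∩ Set.pi univ fun _ => Ico (0 : ℝ) r)).toReal ≤ ((hi S r n : ℚ) : ℝ) := by
  have h1 := le_hi (S := S ∩ Set.pi univ fun _ => Ico (0 : ℝ) r) (r := r) inter_subset_right n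
  refine h1.trans ?_
  have h2 : (hi (S ∩ Set.pi univ fun _ => Ico (0 : ℝ) r) r n : ℚ) ≤ hi S r n := by
    unfold hi
    have := outerCount_mono
      (inter_subset_left (s := S) (t := Set.pi univ fun _ => Ico (0 : ℝ) r)) r n
    gcongr
  exact_mod_cast h2

/-- Closed grid cubes of the grid with `B = r 2ⁿ` digits lie in the closed box `[0, r]^m`.
[folklore]
 -/
theorem cbox_subset_Icc (hr : 0 < r) (n e : ℕ) :
    cbox (m := m) (r * 2 ^ n) n e ⊆ Set.pi univ fun _ => Icc (0 : ℝ) r := by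
  intro x hx i _
  obtain ⟨h1, h2⟩ := hx i (mem_univ i)
  have hpos : (0 : ℝ) < 2 ^ n := by positivity
  have hB : 0 < r * 2 ^ n := Nat.mul_pos hr (Nat.pow_pos two_pos)
  have hd : digit (m := m) (r * 2 ^ n) e i + 1 ≤ r * 2 ^ n := digit_lt hB i
  have hc0 : (0 : ℝ) ≤ corner (m := m) (r * 2 ^ n) n e i := by
    simp only [corner]; positivity
  have hc1 : corner (m := m) (r * 2 ^ n) n e i + 1 / 2 ^ n ≤ r := by
    simp only [corner]
    rw [← add_div, div_le_iff₀ hpos]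
    exact_mod_cast hd
  exact ⟨hc0.trans h1, h2.trans hc1⟩

/-- **Gap estimate, localised**: `hi_n − lo_n ≤ vol(N_{2⁻ⁿ}(∂S ∩ [0, r]^m))` — a grid cube meeting
`S` but not inside `S` meets `∂S` inside the closed box. [folklore] -/
theorem hi_sub_lo_le_local (hr : 0 < r) (n : ℕ) :
    ((hi S r n : ℚ) : ℝ) - lo S r n ≤
      (volume (cthickening (1 / 2 ^ n)
        (frontier S ∩ Set.pi univ fun _ => Icc (0 : ℝ) r))).toReal := by
  classical
  set F := frontier S ∩ Set.pi univ fun _ => Icc (0 : ℝ) r with hFdef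
  have hFb : Bornology.IsBounded F :=
    (Bornology.IsBounded.pi fun _ => Metric.isBounded_Icc (0 : ℝ) r).subset inter_subset_right
  have hfin : volume (cthickening (1 / 2 ^ n) F) ≠ ⊤ := (hFb.cthickening).measure_lt_top.ne
  set B := r * 2 ^ n with hB
  set I := (Finset.range (B ^ m)).filter fun e => cbox (m := m) B n e ⊆ S with hIdef
  set J := (Finset.range (B ^ m)).filter fun e => (cbox (m := m) B n e ∩ S).Nonempty with hJdef
  have hIJ : I ⊆ J := by
    intro e he
    rw [Finset.mem_filter] at he ⊢
    obtain ⟨x, hx⟩ := cbox_nonempty (m := m) B n e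
    exact ⟨he.1, x, hx, he.2 hx⟩
  have hbad : ∀ e ∈ J \ I, obox (m := m) B n e ⊆ cthickening (1 / 2 ^ n) F := by
    intro e he w hw
    rw [Finset.mem_sdiff, Finset.mem_filter, Finset.mem_filter, not_and] at he
    obtain ⟨⟨heB, x, hxC, hxS⟩, hnot⟩ := he
    have hnot' : ¬ cbox (m := m) B n e ⊆ S := hnot heB
    rw [Set.not_subset] at hnot'
    obtain ⟨y, hyC, hyS⟩ := hnot'
    obtain ⟨z, hzC, hzF⟩ :=
      exists_mem_frontier_of_isPreconnected (isPreconnected_cbox B n e) hxC hxS hyC hyS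
    have hzF' : z ∈ F := ⟨hzF, cbox_subset_Icc (m := m) hr n e hzC⟩
    exact Metric.mem_cthickening_of_dist_le w z _ _ hzF'
      (dist_le_of_mem_cbox (obox_subset_cbox _ _ _ hw) hzC)
  have hJB : ∀ e ∈ J \ I, e < B ^ m := fun e he =>
    Finset.mem_range.1 (Finset.mem_filter.1 (Finset.mem_sdiff.1 he).1).1
  have hU : (⋃ e ∈ J \ I, obox (m := m) B n e) ⊆ cthickening (1 / 2 ^ n) F := by
    intro w hw
    simp only [mem_iUnion, exists_prop] at hw
    obtain ⟨e, he, hw⟩ := hw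
    exact hbad e he hw
  have h1 := volume_biUnion_obox (n := n) (J \ I) hJB
  have h2 := measure_mono (μ := volume) hU
  rw [h1] at h2
  have h3 := ENNReal.toReal_mono hfin h2
  rw [ENNReal.toReal_mul, ENNReal.toReal_natCast, ENNReal.toReal_ofReal (by positivity),
    Finset.card_sdiff_of_subset hIJ, Nat.cast_sub (Finset.card_le_card hIJ)] at h3
  have : ((hi S r n : ℚ) : ℝ) - lo S r n = ((J.card : ℝ) - I.card) * (1 / 2 ^ n) ^ m := by
    rw [hi, lo, cast_card_div_eq, cast_card_div_eq]
    simp only [innerCount, outerCount, ← hB, ← hIdef, ← hJdef]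
    ring
  rw [this]
  exact h3

/-- **The localised gaps tend to `0`** for every `ℚ`-semialgebraic `S` (bounded or not): the compact
null set `∂S ∩ [0, r]^m` has closed neighbourhoods of volume `→ 0`. [folklore] -/
theorem exists_hi_sub_lo_le_of_isSemialgebraic (hSa : IsSemialgebraic ℚ S) (hr : 0 < r) (p : ℕ) :
    ∃ n, hi S r n - lo S r n ≤ 1 / (2 : ℚ) ^ p := by
  set F := frontier S ∩ Set.pi univ fun _ => Icc (0 : ℝ) r with hFdef
  have hFb : Bornology.IsBounded F :=
    (Bornology.IsBounded.pi fun _ => Metric.isBounded_Icc (0 : ℝ) r).subset inter_subset_right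
  have hFc : IsClosed F :=
    isClosed_frontier.inter (isClosed_set_pi fun _ _ => isClosed_Icc)
  have hF0 : volume F = 0 := measure_mono_null inter_subset_left (volume_frontier_eq_zero hSa)
  have hfinR : ∀ R : ℝ, volume (cthickening R F) ≠ ⊤ := fun R =>
    (hFb.cthickening).measure_lt_top.ne
  have ht : Tendsto (fun δ => volume (cthickening δ F)) (𝓝 0) (𝓝 0) := by
    have := tendsto_measure_cthickening_of_isClosed (μ := volume) (s := F)
      ⟨1, one_pos, hfinR 1⟩ hFc
    rwa [hF0] at this
  have hε : (0 : ℝ≥0∞) < ENNReal.ofReal (1 / 2 ^ p) := by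
    rw [ENNReal.ofReal_pos]; positivity
  have hev := (ENNReal.tendsto_nhds_zero.1 ht) _ hε
  rw [Metric.eventually_nhds_iff] at hev
  obtain ⟨δ, hδ, hδ'⟩ := hev
  obtain ⟨n, hn⟩ := exists_pow_lt_of_lt_one hδ (by norm_num : (1 / 2 : ℝ) < 1)
  refine ⟨n, ?_⟩
  have hn' : dist (1 / (2 : ℝ) ^ n) 0 < δ := by
    rw [Real.dist_eq, sub_zero, abs_of_pos (by positivity), one_div_pow] at *
    simpa [one_div] using hn
  have hle := hδ' hn'
  have hgap := hi_sub_lo_le_local (S := S) hr n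
  have hreal : (volume (cthickening (1 / 2 ^ n) F)).toReal ≤ 1 / 2 ^ p := by
    have := ENNReal.toReal_mono ENNReal.ofReal_ne_top hle
    rwa [ENNReal.toReal_ofReal (by positivity)] at this
  have : (((hi S r n - lo S r n : ℚ)) : ℝ) ≤ ((1 / (2 : ℚ) ^ p : ℚ) : ℝ) := by
    push_cast
    linarith
  exact_mod_cast this


/-! ### Translates of a set and the shifted cube tests -/

/-- The translate `E + r·(1, …, 1) = {y | y − r·1 ∈ E}` of `E` (the grid on `[0, 2r]^m` for this set
is the grid on `[−r, r]^m` for `E`) is the preimage of `E` under `y ↦ (−r)·1 + y`. [folklore] -/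
theorem shift_eq_preimage (r : ℕ) (E : Set (Fin m → ℝ)) :
    {y : Fin m → ℝ | (fun i => y i - (r : ℝ)) ∈ E} =
      (fun y : Fin m → ℝ => (fun _ => -(r : ℝ)) + y) ⁻¹' E := by
  ext y
  simp only [mem_setOf_eq, mem_preimage]
  congr! 1
  funext i
  simp [sub_eq_neg_add]

/-- Translation invariance of Lebesgue measure. [folklore] -/
theorem volume_shift (r : ℕ) (E : Set (Fin m → ℝ)) :
    volume {y : Fin m → ℝ | (fun i => y i - (r : ℝ)) ∈ E} = volume E := by
  rw [shift_eq_preimage, measure_preimage_add]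

/-- Translates of `ℚ`-semialgebraic sets by natural vectors are `ℚ`-semialgebraic. [folklore] -/
theorem isSemialgebraic_shift {E : Set (Fin m → ℝ)} (hE : IsSemialgebraic ℚ E) (r : ℕ) :
    IsSemialgebraic ℚ {y : Fin m → ℝ | (fun i => y i - (r : ℝ)) ∈ E} := by
  convert hE.preimage_aeval
    (fun i : Fin m => (MvPolynomial.X i - MvPolynomial.C (r : ℚ) : MvPolynomial (Fin m) ℚ)) using 1
  ext y
  simp

/-- The part of the translate inside the grid box `[0, 2r)^m` is the translate of `E ∩ [−r, r)^m`.
[folklore] -/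
theorem shift_inter_box (r : ℕ) (E : Set (Fin m → ℝ)) :
    {y : Fin m → ℝ | (fun i => y i - (r : ℝ)) ∈ E} ∩
        (Set.pi univ fun _ => Ico (0 : ℝ) ((2 * r : ℕ) : ℝ)) =
      {y : Fin m → ℝ |
        (fun i => y i - (r : ℝ)) ∈ E ∩ Set.pi univ fun _ => Ico (-(r : ℝ)) r} := by
  ext y
  simp only [mem_inter_iff, mem_setOf_eq, Set.mem_pi, mem_univ, true_implies, mem_Ico, Nat.cast_mul,
    Nat.cast_ofNat]
  refine and_congr_right fun _ => forall_congr' fun i => ?_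
  constructor <;> rintro ⟨h1, h2⟩ <;> constructor <;> linarith

/-- Membership in a parameter box with parameters `(c, δ)`. [folklore] -/
theorem mem_paramBox_snoc {c : Fin m → ℝ} {δ : ℝ} {x : Fin m → ℝ} :
    x ∈ paramBox (Fin.snoc c δ) ↔ ∀ i, c i ≤ x i ∧ x i ≤ c i + δ := by
  simp only [paramBox, Set.mem_pi, mem_univ, true_implies, Fin.snoc_castSucc, Fin.snoc_last,
    mem_Icc]

/-- "Box with corner `c` is inside the translate" iff "box with corner `c − r·1` is inside `E`".
[folklore] -/
theorem paramBox_subset_shift_iff {c : Fin m → ℝ} {δ : ℝ} {r : ℕ} {E : Set (Fin m → ℝ)} :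
    paramBox (Fin.snoc c δ) ⊆ {y : Fin m → ℝ | (fun i => y i - (r : ℝ)) ∈ E} ↔
      paramBox (Fin.snoc (fun i => c i - (r : ℝ)) δ) ⊆ E := by
  constructor
  · intro h x hx
    rw [mem_paramBox_snoc] at hx
    have hx' : (fun i => x i + (r : ℝ)) ∈ paramBox (Fin.snoc c δ) := by
      rw [mem_paramBox_snoc]
      intro i
      obtain ⟨h1, h2⟩ := hx i
      constructor <;> linarith
    have := h hx'
    rw [mem_setOf_eq] at this
    convert this using 1
    funext i
    simp
  · intro h x hx
    rw [mem_paramBox_snoc] at hx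
    rw [mem_setOf_eq]
    apply h
    rw [mem_paramBox_snoc]
    intro i
    obtain ⟨h1, h2⟩ := hx i
    constructor <;> linarith

/-- "Box with corner `c` meets the translate" iff "box with corner `c − r·1` meets `E`". [folklore]
 -/
theorem paramBox_inter_shift_nonempty_iff {c : Fin m → ℝ} {δ : ℝ} {r : ℕ} {E : Set (Fin m → ℝ)} :
    (paramBox (Fin.snoc c δ) ∩ {y : Fin m → ℝ | (fun i => y i - (r : ℝ)) ∈ E}).Nonempty ↔
      (paramBox (Fin.snoc (fun i => c i - (r : ℝ)) δ) ∩ E).Nonempty := by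
  constructor
  · rintro ⟨x, hx, hxE⟩
    rw [mem_paramBox_snoc] at hx
    refine ⟨fun i => x i - (r : ℝ), ?_, hxE⟩
    rw [mem_paramBox_snoc]
    intro i
    obtain ⟨h1, h2⟩ := hx i
    constructor <;> linarith
  · rintro ⟨x, hx, hxE⟩
    rw [mem_paramBox_snoc] at hx
    refine ⟨fun i => x i + (r : ℝ), ?_, ?_⟩
    · rw [mem_paramBox_snoc]
      intro i
      obtain ⟨h1, h2⟩ := hx i
      constructor <;> linarith
    · rw [mem_setOf_eq]
      convert hxE using 1
      funext i
      simp

/-- The cube test "cube `⊆` translate by `r·1`" is membership of the real parameter point `(corner −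
r·1, 2⁻ᵖ)` in `innerParams E`. [folklore] -/
theorem cbox_subset_shift_iff (r B p e : ℕ) (E : Set (Fin m → ℝ)) :
    cbox (m := m) B p e ⊆ {y : Fin m → ℝ | (fun i => y i - (r : ℝ)) ∈ E} ↔
      Fin.snoc (fun i => corner (m := m) B p e i - (r : ℝ)) (1 / 2 ^ p) ∈ innerParams E := by
  rw [cbox_eq_paramBox, paramBox_subset_shift_iff]
  rfl

/-- The cube test "cube meets the translate by `r·1`" is membership of the real parameter point
`(corner − r·1, 2⁻ᵖ)` in `outerParams E`. [folklore] -/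
theorem cbox_inter_shift_nonempty_iff (r B p e : ℕ) (E : Set (Fin m → ℝ)) :
    (cbox (m := m) B p e ∩ {y : Fin m → ℝ | (fun i => y i - (r : ℝ)) ∈ E}).Nonempty ↔
      Fin.snoc (fun i => corner (m := m) B p e i - (r : ℝ)) (1 / 2 ^ p) ∈ outerParams E := by
  rw [cbox_eq_paramBox, paramBox_inter_shift_nonempty_iff]
  rfl

/-! ### Joint primitive recursiveness of the shifted Riemann sums -/

open Literature.Computability.Complexity in
/-- Along the grids of the translates `E + ρ(n)·1` on `[0, 2ρ(n)]^m`, membership of the real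
parameter point `(corner − ρ(n)·1, 2⁻ᵖ)` of the `e`-th cube of mesh `2⁻ᵖ` in a fixed
`ℚ`-semialgebraic set `G ⊆ ℝ^{m+1}` is a primitive recursive predicate of `((n, p), e)` when `ρ` is
primitive recursive: the point is the cast of a primitive recursive rational vector, and rational
points of a `ℚ`-semialgebraic set are recognised primitive recursively (`primrecPred_mem`; Yoshinaga
2008, proof of Lemma 26). [cite: Yoshinaga2008, Lemma 26] -/
theorem primrecPred_snoc_corner_mem {G : Set (Fin (m + 1) → ℝ)} (hG : IsSemialgebraic ℚ G)
    {ρ : ℕ → ℕ} (hρ : Primrec ρ) :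
    PrimrecPred fun t : (ℕ × ℕ) × ℕ =>
      Fin.snoc (fun i => corner (m := m) (2 * ρ t.1.1 * 2 ^ t.1.2) t.1.2 t.2 i - (ρ t.1.1 : ℝ))
        (1 / 2 ^ t.1.2) ∈ G := by
  -- the rational parameter vector `(corner − ρ(n)·1, 2⁻ᵖ) ∈ ℚ^{m+1}`
  set π : (ℕ × ℕ) × ℕ → Fin (m + 1) → ℚ := fun t =>
    Fin.snoc (fun i => (digit (m := m) (2 * ρ t.1.1 * 2 ^ t.1.2) t.2 i : ℚ) / 2 ^ t.1.2 - ρ t.1.1)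
      (1 / 2 ^ t.1.2) with hπ
  have hpow : Primrec₂ ((· ^ ·) : ℕ → ℕ → ℕ) := Primrec₂.unpaired'.1 Nat.Primrec.pow
  have hn : Primrec fun t : (ℕ × ℕ) × ℕ => t.1.1 := Primrec.fst.comp Primrec.fst
  have hp : Primrec fun t : (ℕ × ℕ) × ℕ => t.1.2 := Primrec.snd.comp Primrec.fst
  have hρn : Primrec fun t : (ℕ × ℕ) × ℕ => ρ t.1.1 := hρ.comp hn
  have hB : Primrec fun t : (ℕ × ℕ) × ℕ => 2 * ρ t.1.1 * 2 ^ t.1.2 :=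
    Primrec.nat_mul.comp (Primrec.nat_mul.comp (Primrec.const 2) hρn)
      (hpow.comp (Primrec.const 2) hp)
  have hπc : ∀ i, Primrec fun t => π t i := by
    intro i
    refine Fin.lastCases ?_ (fun j => ?_) i
    · simp only [hπ, Fin.snoc_last]
      exact rat_natDivTwoPow_primrec.comp (Primrec.const 1) hp
    · simp only [hπ, Fin.snoc_castSucc]
      have hd : Primrec fun t : (ℕ × ℕ) × ℕ => digit (m := m) (2 * ρ t.1.1 * 2 ^ t.1.2) t.2 j := by
        unfold digit
        exact Primrec.nat_mod.comp
          (Primrec.nat_div.comp Primrec.snd (hpow.comp hB (Primrec.const (j : ℕ)))) hB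
      exact rat_sub_primrec.comp (rat_natDivTwoPow_primrec.comp hd hp)
        (rat_natCast_primrec.comp hρn)
  have hcast : ∀ t : (ℕ × ℕ) × ℕ, (fun i => (π t i : ℝ)) =
      Fin.snoc (fun i => corner (m := m) (2 * ρ t.1.1 * 2 ^ t.1.2) t.1.2 t.2 i - (ρ t.1.1 : ℝ))
        (1 / 2 ^ t.1.2) := by
    intro t
    funext i
    refine Fin.lastCases ?_ (fun j => ?_) i
    · simp [hπ]
    · simp [hπ, corner]
  exact (primrecPred_mem hG hπc).of_eq fun t => by rw [hcast]

open Literature.Computability.Complexity in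
/-- A count of the indices `e < K q` selected by a primitive recursive test on `(q, e)` is a
primitive recursive function of the parameter pair `q`. [folklore] -/
theorem primrec_count₂ {K : ℕ × ℕ → ℕ} (hK : Primrec K) {P : (ℕ × ℕ) × ℕ → Prop}
    (hP : PrimrecPred P) :
    Primrec fun q : ℕ × ℕ =>
      ((List.range (K q)).filter fun e => @decide (P (q, e)) (Classical.dec _)).length := by
  classical
  have hL : Primrec fun q : ℕ × ℕ => (List.range (K q)).map fun e => (q, e) :=
    Primrec.list_map (Primrec.list_range.comp hK) (Primrec.pair Primrec.fst Primrec.snd)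
  have hF := (Primrec.list_length.comp ((Primrec.listFilter hP).comp hL))
  refine hF.of_eq fun q => ?_
  simp only [List.filter_map, List.length_map]
  congr 1

open Literature.Computability.Complexity in
/-- The grid size `(2 ρ(n) 2ᵖ)^m` is primitive recursive in `(n, p)`. [folklore] -/
theorem primrec_gridSize {ρ : ℕ → ℕ} (hρ : Primrec ρ) :
    Primrec fun q : ℕ × ℕ => (2 * ρ q.1 * 2 ^ q.2) ^ m := by
  have hpow : Primrec₂ ((· ^ ·) : ℕ → ℕ → ℕ) := Primrec₂.unpaired'.1 Nat.Primrec.pow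
  exact hpow.comp (Primrec.nat_mul.comp (Primrec.nat_mul.comp (Primrec.const 2)
    (hρ.comp Primrec.fst)) (hpow.comp (Primrec.const 2) Primrec.snd)) (Primrec.const m)

open Literature.Computability.Complexity in
/-- `(n, p) ↦ innerCount (E + ρ(n)·1) (2ρ(n)) p` is primitive recursive: the cube test is membership
of the rational point `(corner − ρ(n)·1, 2⁻ᵖ)` in the fixed `ℚ`-semialgebraic set `innerParams E`
(Yoshinaga 2008, Lemma 26, with the box as an extra parameter). [cite: Yoshinaga2008, Lemma 26] -/
theorem primrec_innerCount_shift {E : Set (Fin m → ℝ)} (hE : IsSemialgebraic ℚ E) {ρ : ℕ → ℕ}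
    (hρ : Primrec ρ) :
    Primrec fun q : ℕ × ℕ =>
      innerCount {y : Fin m → ℝ | (fun i => y i - (ρ q.1 : ℝ)) ∈ E} (2 * ρ q.1) q.2 := by
  classical
  refine (primrec_count₂ (primrec_gridSize (m := m) hρ)
    (primrecPred_snoc_corner_mem (isSemialgebraic_innerParams hE) hρ)).of_eq fun q => ?_
  rw [innerCount, card_filter_range_eq_length]
  congr 1
  apply List.filter_congr
  intro e _
  rw [decide_eq_decide]
  exact (cbox_subset_shift_iff (ρ q.1) _ q.2 e E).symm

open Literature.Computability.Complexity in
/-- `(n, p) ↦ outerCount (E + ρ(n)·1) (2ρ(n)) p` is primitive recursive. [folklore] -/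
theorem primrec_outerCount_shift {E : Set (Fin m → ℝ)} (hE : IsSemialgebraic ℚ E) {ρ : ℕ → ℕ}
    (hρ : Primrec ρ) :
    Primrec fun q : ℕ × ℕ =>
      outerCount {y : Fin m → ℝ | (fun i => y i - (ρ q.1 : ℝ)) ∈ E} (2 * ρ q.1) q.2 := by
  classical
  refine (primrec_count₂ (primrec_gridSize (m := m) hρ)
    (primrecPred_snoc_corner_mem (isSemialgebraic_outerParams hE) hρ)).of_eq fun q => ?_
  rw [outerCount, card_filter_range_eq_length]
  congr 1
  apply List.filter_congr
  intro e _
  rw [decide_eq_decide]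
  exact (cbox_inter_shift_nonempty_iff (ρ q.1) _ q.2 e E).symm

open Literature.Computability.Complexity in
/-- The shifted inner Riemann sums are primitive recursive in `(n, p)`. [folklore] -/
theorem primrec_lo_shift {E : Set (Fin m → ℝ)} (hE : IsSemialgebraic ℚ E) {ρ : ℕ → ℕ}
    (hρ : Primrec ρ) :
    Primrec fun q : ℕ × ℕ =>
      lo {y : Fin m → ℝ | (fun i => y i - (ρ q.1 : ℝ)) ∈ E} (2 * ρ q.1) q.2 :=
  (rat_natDivTwoPow_primrec.comp (primrec_innerCount_shift hE hρ)
    (Primrec.nat_mul.comp Primrec.snd (Primrec.const m))).of_eq fun _ => rfl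

open Literature.Computability.Complexity in
/-- The shifted outer Riemann sums are primitive recursive in `(n, p)`. [folklore] -/
theorem primrec_hi_shift {E : Set (Fin m → ℝ)} (hE : IsSemialgebraic ℚ E) {ρ : ℕ → ℕ}
    (hρ : Primrec ρ) :
    Primrec fun q : ℕ × ℕ =>
      hi {y : Fin m → ℝ | (fun i => y i - (ρ q.1 : ℝ)) ∈ E} (2 * ρ q.1) q.2 :=
  (rat_natDivTwoPow_primrec.comp (primrec_outerCount_shift hE hρ)
    (Primrec.nat_mul.comp Primrec.snd (Primrec.const m))).of_eq fun _ => rfl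


/-! ### Finite-volume sets with an effective tail have computable volume -/

open Literature.Computability.Complexity in
/-- **Exhaustion with an effective tail.** Let `E ⊆ ℝ^m` be `ℚ`-semialgebraic of finite volume, and
let `ρ : ℕ → ℕ` be a primitive recursive sequence of box radii with `vol(E ∖ [−ρ(n), ρ(n))^m) ≤
2^{−(n+2)}`. Then `vol E` is a computable real: with `(n, p)` coded by one index, `lo = #(cubes of
mesh 2⁻ᵖ in [−ρ(n), ρ(n)]^m inside E)·2^{−pm} ≤ vol E ≤ #(cubes meeting E)·2^{−pm} + 2^{−(n+2)} =
hi`, both sequences are computable (the cube tests are primitive recursive,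
`primrec_innerCount_shift`), and `hi − lo ≤ 2^{−n}` for suitable `p` because the localised gaps tend
to `0` (`exists_hi_sub_lo_le_of_isSemialgebraic`); conclude by `IsComputableReal.of_twoSided`
(Weihrauch 2000, Lemma 4.2.1). [cite: Weihrauch2000, Lemma 4.2.1] -/
theorem isComputableReal_volume_of_tailSeq {E : Set (Fin m → ℝ)} (hE : IsSemialgebraic ℚ E)
    (hfin : volume E ≠ ⊤) {ρ : ℕ → ℕ} (hρ : Primrec ρ) (hρpos : ∀ n, 0 < ρ n)
    (htail : ∀ n, volume (E \ Set.pi univ fun _ => Ico (-(ρ n : ℝ)) (ρ n)) ≤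
      ENNReal.ofReal (1 / 2 ^ (n + 2))) :
    IsComputableReal (volume E).toReal := by
  classical
  -- translates `E + ρ(n)·1`: their grids on `[0, 2ρ(n)]^m` are those of `E` on `[−ρ(n), ρ(n)]^m`
  let T : ℕ → Set (Fin m → ℝ) := fun n => {y : Fin m → ℝ | (fun i => y i - (ρ n : ℝ)) ∈ E}
  set lo' : ℕ → ℚ := fun j => lo (T j.unpair.1) (2 * ρ j.unpair.1) j.unpair.2 with hlo'
  set hi' : ℕ → ℚ := fun j =>
    hi (T j.unpair.1) (2 * ρ j.unpair.1) j.unpair.2 + 1 / 2 ^ (j.unpair.1 + 2) with hhi'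
  have hlo'c : Computable lo' := ((primrec_lo_shift hE hρ).comp Primrec.unpair).to_comp
  have hhi'c : Computable hi' :=
    (rat_add_primrec.comp ((primrec_hi_shift hE hρ).comp Primrec.unpair)
      (rat_natDivTwoPow_primrec.comp (Primrec.const 1)
        (Primrec.nat_add.comp (Primrec.fst.comp Primrec.unpair) (Primrec.const 2)))).to_comp
  refine IsComputableReal.of_twoSided lo' hi' hlo'c hhi'c (fun j => ?_) (fun j => ?_) (fun N => ?_)
  · -- lower bound
    have h := lo_le_of_ne_top (S := T j.unpair.1) (r := 2 * ρ j.unpair.1)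
      (by rwa [volume_shift]) j.unpair.2
    rwa [volume_shift] at h
  · -- upper bound: the box part is below `hi`, the tail is below `2^{-(n+2)}`
    set n := j.unpair.1 with hn
    set p := j.unpair.2 with hp
    set B : Set (Fin m → ℝ) := Set.pi univ fun _ => Ico (-(ρ n : ℝ)) (ρ n) with hB
    have hBm : MeasurableSet B := MeasurableSet.univ_pi fun _ => measurableSet_Ico
    have hsplit : volume E = volume (E ∩ B) + volume (E \ B) :=
      (measure_inter_add_sdiff E hBm).symm
    have h1 : (volume (E ∩ B)).toReal ≤ ((hi (T n) (2 * ρ n) p : ℚ) : ℝ) := by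
      have := volume_inter_box_le_hi (T n) (2 * ρ n) p
      rwa [shift_inter_box, volume_shift] at this
    have h2 : (volume (E \ B)).toReal ≤ 1 / 2 ^ (n + 2) := by
      have := ENNReal.toReal_mono ENNReal.ofReal_ne_top (htail n)
      rwa [ENNReal.toReal_ofReal (by positivity)] at this
    have hfin1 : volume (E ∩ B) ≠ ⊤ := measure_ne_top_of_subset inter_subset_left hfin
    have hfin2 : volume (E \ B) ≠ ⊤ := measure_ne_top_of_subset Set.sdiff_subset hfin
    rw [hsplit, ENNReal.toReal_add hfin1 hfin2]
    have : ((hi' j : ℚ) : ℝ) = ((hi (T n) (2 * ρ n) p : ℚ) : ℝ) + 1 / 2 ^ (n + 2) := by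
      simp only [hhi', ← hn, ← hp]
      push_cast
      ring
    rw [this]
    exact add_le_add h1 h2
  · -- gaps
    have hr : 0 < 2 * ρ N := Nat.mul_pos two_pos (hρpos N)
    obtain ⟨p, hgap⟩ :=
      exists_hi_sub_lo_le_of_isSemialgebraic (isSemialgebraic_shift hE (ρ N)) hr (N + 2)
    refine ⟨Nat.pair N p, ?_⟩
    simp only [hlo', hhi', Nat.unpair_pair, T]
    have h2N : (0 : ℚ) < 2 ^ N := by positivity
    have key : (1 : ℚ) / 2 ^ (N + 2) + 1 / 2 ^ (N + 2) = 1 / 2 ^ N * (1 / 2) := by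
      rw [pow_add]; ring
    have key' : (1 : ℚ) / 2 ^ N * (1 / 2) ≤ 1 / 2 ^ N :=
      mul_le_of_le_one_right (by positivity) (by norm_num)
    linarith

open Literature.Computability.Complexity in
/-- **Finite-volume `ℚ`-semialgebraic sets with polynomially decaying tails have computable
volume.** If `E ⊆ ℝ^m` is `ℚ`-semialgebraic, `vol E < ∞` and `vol(E ∖ B(0, R)) ≤ C R^{−a}` for `R ≥
1` (`a > 0`; sup-norm balls), then `vol E` is a computable real: take `ρ(n) = D·2^{Kn}` with `K a ≥
1` and `C D^{−a} ≤ 1/4` in `isComputableReal_volume_of_tailSeq`. The tail hypothesis is a theorem of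
tame integration theory — `R ↦ vol(E ∖ B(0, R))` is a constructible function of `R` [Cluckers–Miller
2011, Thm. 1.3 (stability under integration)] tending to `0`, hence `≤ R^{−r}` for large `R`
[Cluckers–Miller 2011, Prop. 1.5 (decay rates)] — and is an explicit hypothesis here, not vendored
as a fact. [cite: Weihrauch2000, Lemma 4.2.1] -/
theorem isComputableReal_volume_of_tailDecay {E : Set (Fin m → ℝ)} (hE : IsSemialgebraic ℚ E)
    (hfin : volume E ≠ ⊤) {C a : ℝ} (ha : 0 < a)
    (htail : ∀ R : ℝ, 1 ≤ R → volume (E \ Metric.ball 0 R) ≤ ENNReal.ofReal (C * R ^ (-a))) :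
    IsComputableReal (volume E).toReal := by
  -- a nonnegative constant
  set C' : ℝ := max C 0 with hC'
  have hC'0 : 0 ≤ C' := le_max_right _ _
  have htail' : ∀ R : ℝ, 1 ≤ R → volume (E \ Metric.ball 0 R) ≤ ENNReal.ofReal (C' * R ^ (-a)) :=
    fun R hR => (htail R hR).trans (ENNReal.ofReal_le_ofReal
      (mul_le_mul_of_nonneg_right (le_max_left _ _) (Real.rpow_nonneg (by linarith) _)))
  -- the exponent `K` with `K a ≥ 1`
  set K : ℕ := ⌈1 / a⌉₊ with hK
  have hKa : 1 ≤ (K : ℝ) * a := by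
    have h1 : 1 / a ≤ K := Nat.le_ceil _
    have := mul_le_mul_of_nonneg_right h1 ha.le
    rwa [one_div, inv_mul_cancel₀ ha.ne'] at this
  -- the factor `D` with `C' D^{-a} ≤ 1/4`
  set y : ℝ := (4 * C' + 4) ^ (1 / a) with hy
  have hy0 : 0 ≤ y := Real.rpow_nonneg (by linarith) _
  set D : ℕ := ⌈y⌉₊ + 1 with hD
  have hD1 : 1 ≤ D := Nat.le_add_left 1 _
  have hyD : y ≤ D := by
    rw [hD]; push_cast
    exact (Nat.le_ceil y).trans (le_add_of_nonneg_right zero_le_one)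
  have hDpos : (0 : ℝ) < D := by exact_mod_cast hD1
  have hDa : 4 * C' + 4 ≤ (D : ℝ) ^ a := by
    have h1 : y ^ a ≤ (D : ℝ) ^ a := Real.rpow_le_rpow hy0 hyD ha.le
    have h2 : y ^ a = 4 * C' + 4 := by
      rw [hy, ← Real.rpow_mul (by linarith), one_div, inv_mul_cancel₀ ha.ne', Real.rpow_one]
    linarith
  have hCD : C' * (D : ℝ) ^ (-a) ≤ 1 / 4 := by
    rw [Real.rpow_neg hDpos.le, ← div_eq_mul_inv, div_le_iff₀ (Real.rpow_pos_of_pos hDpos a)]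
    linarith
  -- the radii
  set ρ : ℕ → ℕ := fun n => D * 2 ^ (K * n) with hρ
  have hpow : Primrec₂ ((· ^ ·) : ℕ → ℕ → ℕ) := Primrec₂.unpaired'.1 Nat.Primrec.pow
  have hρc : Primrec ρ :=
    Primrec.nat_mul.comp (Primrec.const D)
      (hpow.comp (Primrec.const 2) (Primrec.nat_mul.comp (Primrec.const K) Primrec.id))
  have hρpos : ∀ n, 0 < ρ n := fun n => Nat.mul_pos hD1 (Nat.pow_pos two_pos)
  have hρ1 : ∀ n, (1 : ℝ) ≤ ρ n := fun n => by exact_mod_cast hρpos n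
  refine isComputableReal_volume_of_tailSeq hE hfin hρc hρpos fun n => ?_
  -- the box contains the ball
  have hsub : E \ Set.pi univ (fun _ => Ico (-(ρ n : ℝ)) (ρ n)) ⊆ E \ Metric.ball 0 (ρ n) := by
    refine Set.sdiff_subset_sdiff_right fun y hy => ?_
    rw [Metric.mem_ball, dist_zero_right] at hy
    intro i _
    have hi : |y i| < ρ n := lt_of_le_of_lt (by simpa using norm_le_pi_norm y i) hy
    rw [abs_lt] at hi
    exact ⟨hi.1.le, hi.2⟩
  refine (measure_mono hsub).trans ((htail' _ (hρ1 n)).trans (ENNReal.ofReal_le_ofReal ?_))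
  -- the rate: `C' ρ(n)^{-a} ≤ 2^{-(n+2)}`
  have hρeq : ((ρ n : ℕ) : ℝ) = (D : ℝ) * (2 : ℝ) ^ ((K * n : ℕ) : ℝ) := by
    rw [Real.rpow_natCast]
    simp [hρ]
  have h2pos : (0 : ℝ) < (2 : ℝ) ^ ((K * n : ℕ) : ℝ) := Real.rpow_pos_of_pos two_pos _
  rw [hρeq, Real.mul_rpow hDpos.le h2pos.le, ← Real.rpow_mul zero_le_two, ← mul_assoc]
  have h3 : (2 : ℝ) ^ (((K * n : ℕ) : ℝ) * -a) ≤ 1 / 2 ^ n := by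
    have : (1 : ℝ) / 2 ^ n = (2 : ℝ) ^ (-(n : ℝ)) := by
      rw [Real.rpow_neg zero_le_two, Real.rpow_natCast, one_div]
    rw [this]
    refine Real.rpow_le_rpow_of_exponent_le one_le_two ?_
    have hn0 : (0 : ℝ) ≤ n := Nat.cast_nonneg n
    have : (n : ℝ) ≤ (K : ℝ) * a * n := by nlinarith
    push_cast
    nlinarith
  have h4 : (0 : ℝ) ≤ (2 : ℝ) ^ (((K * n : ℕ) : ℝ) * -a) := Real.rpow_nonneg zero_le_two _
  calc C' * (D : ℝ) ^ (-a) * (2 : ℝ) ^ (((K * n : ℕ) : ℝ) * -a)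
      ≤ 1 / 4 * (1 / 2 ^ n) := mul_le_mul hCD h3 h4 (by norm_num)
    _ = 1 / 2 ^ (n + 2) := by rw [pow_add]; ring

end SemialgVolume

/-! ### Periods: reduction of Yoshinaga's computability statement to tail decay -/

namespace KZ

namespace IntegralRep

variable {n : ℕ}

open Literature.Computability.Complexity in
/-- **Integral representations are computable, granted polynomial tail decay of finite-volume
`ℚ`-semialgebraic sets.** The value `∫_σ f` of any integral representation (unbounded `σ` and `f`
allowed) is `vol(E₊) − vol(E₋)` for the strict subgraphs `E± = {(x, t) | x ∈ σ, 0 < t < ±f x}` ("the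
integral of a function is the area under its graph", Kontsevich–Zagier 2001, §1.1), which are
`ℚ`-semialgebraic (graph elimination, Tarski–Seidenberg) of finite volume `∫_σ f^±`; under the tail
hypothesis their volumes are computable (`SemialgVolume.isComputableReal_volume_of_tailDecay`).
[cite: KontsevichZagier2001, §1.1] -/
theorem isComputableReal_value_of_tailDecay (r : IntegralRep n)
    (H : ∀ (m : ℕ) (E : Set (Fin m → ℝ)), IsSemialgebraic ℚ E → volume E ≠ ⊤ →
      ∃ C a : ℝ, 0 < a ∧ ∀ R : ℝ, 1 ≤ R →
        volume (E \ Metric.ball 0 R) ≤ ENNReal.ofReal (C * R ^ (-a))) :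
    IsComputableReal r.value := by
  have hTS : Literature.ModelTheory.ExponentialFields.tarski_seidenberg_real (k := ℚ) :=
    Literature.ModelTheory.ExponentialFields.tarski_seidenberg_real_holds
  have hσm : MeasurableSet r.domain := IntegralRep.measurableSet_domain_holds r
  -- the two subgraphs
  set E : ((Fin n → ℝ) → ℝ) → Set (Fin (n + 1) → ℝ) := fun g =>
    {v | Fin.init v ∈ r.domain ∧ 0 < v (Fin.last n) ∧ v (Fin.last n) < g (Fin.init v)} with hE
  have hT : IsSemialgebraic ℚ {u : Fin (n + 2) → ℝ |
      0 < u (Fin.castSucc (Fin.last n)) ∧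
        u (Fin.castSucc (Fin.last n)) < u (Fin.last (n + 1))} := by
    have h1 := isSemialgebraic_setOf_eval_pos (k := ℚ) (R := ℝ)
      (MvPolynomial.X (Fin.castSucc (Fin.last n)) : MvPolynomial (Fin (n + 2)) ℚ)
    have h2 := isSemialgebraic_setOf_eval_lt (k := ℚ) (R := ℝ)
      (MvPolynomial.X (Fin.castSucc (Fin.last n)) : MvPolynomial (Fin (n + 2)) ℚ)
      (MvPolynomial.X (Fin.last (n + 1)))
    convert h1.inter h2 using 1
    ext u
    simp [Set.mem_inter_iff]
  have hEsa : ∀ g, IsSemialgebraicFunOn ℚ r.domain g → IsSemialgebraic ℚ (E g) := by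
    intro g hg
    convert hg.isSemialgebraic_setOf_snoc_mem hTS hT using 1
    ext v
    simp [hE]
  have hEvol : ∀ g, IsSemialgebraicFunOn ℚ r.domain g → IntegrableOn g r.domain →
      volume (E g) = ENNReal.ofReal (∫ x in r.domain, max (g x) 0) := by
    intro g hg hgi
    rw [hE]
    exact volume_subgraph_eq hσm (hg.measurable_indicator_of_tarskiSeidenberg hTS hσm) hgi
  have hf := r.isSemialgebraicFunOn_integrand
  have hfi := r.integrableOn
  have hval : r.value = (volume (E r.integrand)).toReal - (volume (E (-r.integrand))).toReal := by
    rw [hEvol _ hf hfi, hEvol _ hf.neg hfi.neg,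
      ENNReal.toReal_ofReal (setIntegral_nonneg hσm fun x _ => le_max_right _ _),
      ENNReal.toReal_ofReal (setIntegral_nonneg hσm fun x _ => le_max_right _ _)]
    simp only [Pi.neg_apply]
    rw [← integral_sub hfi.pos_part hfi.neg_part, value]
    refine integral_congr_ae (Eventually.of_forall fun x => ?_)
    exact (max_zero_sub_max_neg_zero_eq_self (r.integrand x)).symm
  have hcomp : ∀ g, IsSemialgebraicFunOn ℚ r.domain g → IntegrableOn g r.domain →
      IsComputableReal (volume (E g)).toReal := by
    intro g hg hgi
    have hne : volume (E g) ≠ ⊤ := by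
      rw [hEvol g hg hgi]; exact ENNReal.ofReal_ne_top
    obtain ⟨C, a, ha, hCa⟩ := H (n + 1) (E g) (hEsa g hg) hne
    exact SemialgVolume.isComputableReal_volume_of_tailDecay (hEsa g hg) hne ha hCa
  rw [hval]
  exact (hcomp _ hf hfi).sub (hcomp _ hf.neg hfi.neg)

end IntegralRep

end KZ

open Literature.Computability.Complexity in
/-- **Real periods are computable, granted polynomial tail decay of finite-volume `ℚ`-semialgebraic
sets** — a resolution-free route to Yoshinaga's computability statement
`isComputableReal_of_isRealPeriod` [Yoshinaga 2008, Thm. 18 (Thm. 1.1 of the statement file)]: the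
printed proofs (Yoshinaga, Lemma 24 (i); Tent–Ziegler 2010, Cor. 6.4; Viu-Sos 2021, Thm. 1.1) first
make the domain and the integrand bounded by Hironaka's rectilinearization; here instead the period
is exhausted by boxes, and the only input not proved in the tree is the tail estimate `vol(E ∖ B(0,
R)) = O(R^{−a})` for `ℚ`-semialgebraic `E` of finite volume — the function `R ↦ vol(E ∖ B(0, R))` is
constructible by [Cluckers–Miller 2011, Thm. 1.3] and tends to `0`, so [Cluckers–Miller 2011, Prop.
1.5: "Let `f` be in `C(X × ℝ)` … and suppose that `lim_{y→+∞} f(x,y) = 0` for all `x ∈ X`. Then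
there exist a constant `r > 0` and a subanalytic function `g : X → (0,+∞)` such that `|f(x,y)| ≤
y^{−r}` for all `x ∈ X` and all `y` with `y > g(x)`"] applies with `X` a point — taken as the
explicit hypothesis `H` (all dimensions, sup-norm balls) and NOT vendored as a named fact (its proof
needs the Lion–Rolin preparation theorem, a theory not in the tree). [cite: Yoshinaga2008, Thm. 18]
 -/
theorem isComputableReal_of_isRealPeriod_of_tailDecay
    (H : ∀ (m : ℕ) (E : Set (Fin m → ℝ)), IsSemialgebraic ℚ E → volume E ≠ ⊤ →
      ∃ C a : ℝ, 0 < a ∧ ∀ R : ℝ, 1 ≤ R →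
        volume (E \ Metric.ball 0 R) ≤ ENNReal.ofReal (C * R ^ (-a))) :
    isComputableReal_of_isRealPeriod := by
  intro x hx
  obtain ⟨n, σ, p, q, hσ, hq, hint, rfl⟩ := hx
  have := (KZ.IntegralRep.ofRational σ p q hσ hq hint).isComputableReal_value_of_tailDecay H
  rwa [KZ.IntegralRep.value_ofRational] at this

/-- **Periods are computable complex numbers, granted polynomial tail decay** (complex form of the
previous theorem: a period has real-period real and imaginary parts). [cite: Yoshinaga2008, Thm. 18
complex form] -/
theorem isComputableComplex_of_isPeriod_of_tailDecay
    (H : ∀ (m : ℕ) (E : Set (Fin m → ℝ)), IsSemialgebraic ℚ E → volume E ≠ ⊤ →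
      ∃ C a : ℝ, 0 < a ∧ ∀ R : ℝ, 1 ≤ R →
        volume (E \ Metric.ball 0 R) ≤ ENNReal.ofReal (C * R ^ (-a))) :
    isComputableComplex_of_isPeriod := by
  intro z hz
  exact ⟨isComputableReal_of_isRealPeriod_of_tailDecay H hz.1,
    isComputableReal_of_isRealPeriod_of_tailDecay H hz.2⟩

end Literature.NumberTheory.Transcendental
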